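import Literature.AnabelianGeometry.EtaleTheta.Discharge.Sec5Cor512OfConnectedTemperoidVocab

/-!
# [EtTh] Corollary 5.12 at the GENUINE §5 data: the `B_N` line-bundle input ELIMINATED — the whole Corollary modulo ONE
# printed sentence (the `B_{N'}` line bundle), optionally in print's degree currency

Mochizuki, *The étale theta function and its Frobenioid-theoretic manifestations*, Publ. RIMS **45** (2009), Cor. 5.12
pp.339–340 (PDF pp.113–114) and its proof p.340 l.−8 – p.341 l.9 (PDF pp.114–115): «Since `β_{N,N'}` is an isometry of
Frobenius degree `M`, it follows that the pull-back via the morphism `B^bs_{N'} → B^bs_N` of `D` of the line bundle that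
determines the object `B_N` is isomorphic to the `M`-th tensor power of the line bundle that determines the object `B_{N'}`.
Moreover, it follows immediately from the discussion of line bundles in §1 [cf. the discussion preceding Proposition 1.1]
that all positive tensor powers of these line bundles are nontrivial …» [cite: MochizukiEtTh2009, Cor 5.12 proof p.340–341 (PDF pp.114–115)];
§1 p.240 (PDF p.14) l.5–12: «the isomorphism class of a line bundle on `Y_N` is completely determined by the degree of the
restriction of the line bundle to each of these copies of the projective line … these degrees may be used to define an
isomorphism `Pic(Y_N) ⥲ ℤ^ℤ`» [cite: MochizukiEtTh2009, §1 p.240 (PDF p.14)]; [FrdI] Thm. 5.2 (i) p.100 (the relation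
`deg_Fr(φ)·α + Div(φ) = Φ(Base(φ))(β) + Div_B(u_φ)` of a morphism of the model Frobenioid) [cite: MochizukiFrdI2008, Thm. 5.2 (i) p.100].

abc-iut cell, layer L2, seat abc-iut-L2-t4 (gen 8; typer of record of Cor. 5.12, p407037 / p403850), row «COUNT-CENSUS
EtTh:Cor5.12(i)/(ii)/(iii)»; GAP row G-f112-1 (the two §1 line-bundle inputs `hL`, `hL'`).  PROOF-ONLY sequel of abc-iut-f-112's
`Sec5Cor512ModelCase` (p436682) / `Sec5Cor512OfConnectedTemperoid` (p444710) / `Sec5Cor512OfConnectedTemperoidVocab` (p445319):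
no definition, no new `Prop`, no instance; nothing landed is edited.

WHAT THIS FILE DOES.  The closers of record carry TWO line-bundle binders: `hL` («the class of `B_N` is not principal») and `hL'`
(«no positive tensor power of the class of `B_{N'}` is principal»).  Print's FIRST sentence above already derives the `B_N`
statement from the `B_{N'}` statement: relation (d) of the isometry `β_{N,N'} = (M, β^bs, 0, u_β)` reads
`cls(B_{N'})^M = (β^bs)^* cls(B_N) · Div_B(u_β)`, so a principal `cls(B_N) = Div_B(u)` would make the `M`-th power of `cls(B_{N'})`
principal.  Hence
* `Model.cls_ne_divB_of_isometry` — **`hL` FOLLOWS FROM `hL'`** along any isometry (any Frobenius degree `≥ 1`);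
* `Model.pow_cls_ne_divB_of_degree` — `hL'` in print's §1 currency: it follows from ANY monoid homomorphism
  `deg : Φ(B_{N'}^bs)^gp → ℤ` killing the principal divisors `Div_B(B(B_{N'}^bs))` and nonzero on `cls(B_{N'})` (p.240: line bundles
  on the tempered coverings are classified by their degrees on the copies of the projective line; a log-meromorphic function has a
  degree-zero divisor; `L_{N'}` has degree 1 on each copy);
* at the model (`RootMorphismData.isoClassesDistinct_of_model_of_isGaloisObj_obj_of_hL'`, `…OfSystems…`) and at abc-iut-L2-t4's
  GENUINE §5 data over `B^temp(Π^tp_X)⁰` with the genuine Prop. 5.2 (i) vocabulary: **Cor. 5.12 (i), (iii) (every `ζ`) and the whole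
  Corollary hold modulo EXACTLY ONE displayed clause `hL'`** (`isoClassesDistinct_ofConnectedTemperoidData_of_hL'`,
  `constantMultipleIndeterminacy_ofConnectedTemperoidData_of_hL'`, `constantMultipleIndeterminacyOfSystems_ofBiKummerSetting_of_hL'`),
  or modulo one degree functional (`…_of_degree`).  (ii) is already unconditional there (`existsLinearIota_ofBiKummerSetting`, p445319).

HONEST FRAMING: bookkeeping over the tree's constructions; the one remaining input is print's own §1 sentence about the line bundle of
`B_{N'}` (GAP G-f112-1, now halved), for which the abstract tempered Frobenioid `tf` of the junction carries no degree dictionary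
(VNEXT FOUNDATIONS rows 13–14); nothing asserts such data exist for an actual curve; Cor. 5.12 lies outside the [IUTchIII] Cor. 3.12
cone and no side is taken on Cor. 3.12; typed ≠ proved except the theorems below.
-/

noncomputable section

namespace Literature.AnabelianGeometry.EtaleTheta

open CategoryTheory Opposite Literature.AlgebraicGeometry.Frobenioids Literature.AnabelianGeometry.SemiGraphs
open Literature.AnabelianGeometry.SemiGraphs (IsGaloisObj)

universe u₀ v₀ w v u

namespace ConstantMultiple

/-! ### Model level: the `B_N` input from the `B_{N'}` input; the `B_{N'}` input from a degree -/

namespace Model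

variable {D : Type u} [Category.{v} D] {Φ B : Dᵒᵖ ⥤ CommMonCat.{w}} {DivB : B ⟶ monoidGp Φ}

/-- **The line bundle of the codomain of an isometry is nontrivial if no positive power of the line bundle of its domain is
trivial** (Cor. 5.12 proof p.340 l.−2 – p.341 l.5 (PDF pp.114–115): «Since `β_{N,N'}` is an isometry of Frobenius degree `M` … the
pull-back … of the line bundle that determines `B_N` is isomorphic to the `M`-th tensor power of the line bundle that determines
`B_{N'}`»): for `β = (d, β^bs, 0, u_β) : B' → B`, relation (d) is `cls(B')^d = (β^bs)^* cls(B) · Div_B(u_β)`; if `cls(B) = Div_B(u)`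
then `cls(B')^d = Div_B((β^bs)^* u · u_β)`.  [cite: MochizukiEtTh2009, Cor 5.12 proof p.340–341 (PDF pp.114–115)]
[cite: MochizukiFrdI2008, Thm. 5.2 (i) p.100] -/
theorem cls_ne_divB_of_isometry {B' Bo : ModelFrobenioid Φ B DivB} (β : B' ⟶ Bo) (hβ : ModelFrobenioid.div β = 1)
    (hL' : ∀ k : ℕ, 0 < k → ∀ u : B.obj (op B'.base), B'.cls ^ k ≠ divB Φ B DivB (op B'.base) u) :
    ∀ u : B.obj (op Bo.base), Bo.cls ≠ divB Φ B DivB (op Bo.base) u := by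
  intro u hu
  have hrel := ModelFrobenioid.rel β
  rw [hβ, map_one, mul_one, hu, pullGp_divB, ← map_mul] at hrel
  exact hL' _ (ModelFrobenioid.degFr β).pos _ hrel

/-- **No positive tensor power is trivial, from a degree** (§1 p.240 (PDF p.14): «the isomorphism class of a line bundle on `Y_N` is
completely determined by the degree of the restriction of the line bundle to each of these copies of the projective line»): if some
monoid homomorphism `deg : Φ(B'^bs)^gp → ℤ` kills every principal divisor `Div_B(u)` and `deg(cls(B')) ≠ 0`, then
`cls(B')^k ∉ Div_B(B(B'^bs))` for every `k ≥ 1` (`deg(cls(B')^k) = k · deg(cls(B')) ≠ 0`).  [cite: MochizukiEtTh2009, §1 p.240 (PDF p.14)] -/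
theorem pow_cls_ne_divB_of_degree {B' : ModelFrobenioid Φ B DivB}
    (deg : Algebra.GrothendieckGroup (Φ.obj (op B'.base)) →* Multiplicative ℤ)
    (hdegB : ∀ u : B.obj (op B'.base), deg (divB Φ B DivB (op B'.base) u) = 1) (hdegL : deg B'.cls ≠ 1) :
    ∀ k : ℕ, 0 < k → ∀ u : B.obj (op B'.base), B'.cls ^ k ≠ divB Φ B DivB (op B'.base) u := by
  intro k hk u h
  have hx : deg B'.cls ^ k = 1 := by rw [← map_pow, h, hdegB]
  apply hdegL
  have hz : (k : ℤ) * Multiplicative.toAdd (deg B'.cls) = 0 := by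
    have := congrArg Multiplicative.toAdd hx
    rwa [toAdd_pow, toAdd_one, nsmul_eq_mul] at this
  rcases mul_eq_zero.mp hz with h0 | h0
  · exact absurd h0 (by exact_mod_cast hk.ne')
  · exact toAdd_eq_zero.mp h0

end Model

/-! ### Cor. 5.12 for §5 data over the model Frobenioid, `hL` eliminated -/

namespace RootMorphismData

variable {D : Type u} [Category.{v} D] {Φ B : Dᵒᵖ ⥤ CommMonCat.{w}} {DivB : B ⟶ monoidGp Φ}
  {𝔉 : ThetaFrobenioid.{w} (ModelFrobenioid Φ B DivB) D} {V : FrobenioidThetaBiKummer.BiKummerVocabStub 𝔉}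
  (R : RootMorphismData 𝔉 V)

/-- **`hL` from `hL'` for a Cor. 5.12 datum over the model**: `β_{N,N'}` is an isometry (`R.isIsometry_β`), so «the class of `B_N` is
not principal» follows from «no positive power of the class of `B_{N'}` is principal».
[cite: MochizukiEtTh2009, Cor 5.12 proof p.340–341 (PDF pp.114–115)] -/
theorem cls_BN_ne_divB_of_model (h𝔉 : 𝔉.pre = PreFrobenioidData.ofModel Φ B DivB)
    (hL' : ∀ k : ℕ, 0 < k → ∀ u : B.obj (op R.BN'.base), R.BN'.cls ^ k ≠ divB Φ B DivB (op R.BN'.base) u) :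
    ∀ u : B.obj (op 𝔉.BN.base), 𝔉.BN.cls ≠ divB Φ B DivB (op 𝔉.BN.base) u := by
  have hβ : 𝔉.pre.div R.β = 1 := R.isIsometry_β
  revert hβ
  rw [h𝔉]
  intro hβ
  exact Model.cls_ne_divB_of_isometry R.β hβ hL'

end RootMorphismData

namespace RootMorphismData

variable {E : Type u} [Category.{v} E] {P : ObjectProperty E}
  {Φ B : (P.FullSubcategory)ᵒᵖ ⥤ CommMonCat.{w}} {DivB : B ⟶ monoidGp Φ}
  {𝔉 : ThetaFrobenioid.{w} (ModelFrobenioid Φ B DivB) P.FullSubcategory}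
  {V : FrobenioidThetaBiKummer.BiKummerVocabStub 𝔉} (R : RootMorphismData 𝔉 V)

/-- **[EtTh] Cor. 5.12 (i) at the MODEL over a full-subcategory base with `(B_N^bs).obj` Galois, modulo the ONE line-bundle clause
`hL'`** (F-0505 instance form): abc-iut-f-112's `isoClassesDistinct_of_model_of_isGaloisObj_obj` (p444068) with its `hL` binder
supplied by `cls_BN_ne_divB_of_model`.  [cite: MochizukiEtTh2009, Cor 5.12 (i) p.339 (PDF p.113), proof p.340–341 (PDF pp.114–115)] -/
theorem isoClassesDistinct_of_model_of_isGaloisObj_obj_of_hL' (h𝔉 : 𝔉.pre = PreFrobenioidData.ofModel Φ B DivB)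
    (hΦd : Objectwise (fun M _ => IsDivisorial M) Φ)
    (hA : 𝔉.IsFrobeniusTrivial 𝔉.AN) (hAmp : 𝔉.AutAmpleBN) (hGal : IsGaloisObj (𝔉.base.obj 𝔉.BN).obj)
    (hL' : ∀ k : ℕ, 0 < k → ∀ u : B.obj (op R.BN'.base), R.BN'.cls ^ k ≠ divB Φ B DivB (op R.BN'.base) u) :
    IsoClassesDistinct R :=
  R.isoClassesDistinct_of_model_of_isGaloisObj_obj h𝔉 hΦd hA hAmp hGal (R.cls_BN_ne_divB_of_model h𝔉 hL') hL'

end RootMorphismData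

end ConstantMultiple

/-! ### Cor. 5.12 at the GENUINE §5 data over `B^temp(Π^tp_X)⁰`, modulo ONE clause -/

namespace ThetaFrobenioid

variable {K : Type u₀} [Field K] {X : SemiGraphs.TemperedArithmeticGroup.{u₀} K} {D₀ : Type u₀} [Category.{v₀} D₀]
  {V : FrdIMonoidStub.{w}} {T₀ : RealifiedDivisorMonoids (D₀ := D₀) V}
  {VD : FrdICatStub.{u₀ + 1, u₀, w} (ConnectedPart (BTemp X.Pi))}
  {tf : TemperedFrobenioid T₀ (ConnectedPart (BTemp X.Pi)) VD} {hZ : tf.monoidType = MonoidType.Z}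
  {hP : ∀ A : (ConnectedPart (BTemp X.Pi))ᵒᵖ, IsPerfect (tf.Φ.carrier A)}
  {NH : Subgroup (Field.absoluteGaloisGroup K) → tf.category → ℕ+ → Prop} {A₀ : tf.category}
  {hA₀ : PreFrobenioid.IsFrobeniusTrivial tf.toElem A₀} {hA₀' : SemiGraphs.IsGaloisObj A₀.base.obj}
  {pullFrac : ∀ {A A' : (BiKummerSetting.mkOfConnectedTemperoid X tf hZ hP NH A₀ hA₀ hA₀').C} (_ : A' ⟶ A),
    (BiKummerSetting.mkOfConnectedTemperoid X tf hZ hP NH A₀ hA₀ hA₀').biratUnits A →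
      (BiKummerSetting.mkOfConnectedTemperoid X tf hZ hP NH A₀ hA₀ hA₀').biratUnits A'}
  {lv N : ℕ+} {T : ThetaEnvData.{max u₀ w} N}
  {θ : (BiKummerSetting.mkOfConnectedTemperoid X tf hZ hP NH A₀ hA₀ hA₀').biratUnits
    (BiKummerSetting.mkOfConnectedTemperoid X tf hZ hP NH A₀ hA₀ hA₀').Aodot}
  {Bl : (BiKummerSetting.mkOfConnectedTemperoid X tf hZ hP NH A₀ hA₀ hA₀').C}
  {Pl : (BiKummerSetting.mkOfConnectedTemperoid X tf hZ hP NH A₀ hA₀ hA₀').FractionPair θ Bl}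
  {Rl : (BiKummerSetting.mkOfConnectedTemperoid X tf hZ hP NH A₀ hA₀ hA₀').NthRoot θ Pl lv pullFrac}
  (h : ModelFrobenioid.Hypotheses tf.divisorMonoid tf.ratFnFunctor)
  (Q : FrobenioidTheta.ThetaSubquotientStub.{w} (ConnectedPart (BTemp X.Pi))) (odd_l : Odd (lv : ℕ))
  (R : (BiKummerSetting.mkOfConnectedTemperoid X tf hZ hP NH A₀ hA₀ hA₀').NthRoot Rl.root Rl.pair N pullFrac)
  (ιX : T.PiX ≃ₜ* X.Pi) (K' : Type w) [Field K'] (constEmb : K'ˣ →* tf.biratUnitsModel R.BN)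
  (constEmb_injective : Function.Injective constEmb)
  (hinvc : ∀ g : Aut R.AN.base,
    pull tf.divisorMonoid g.hom (ModelFrobenioid.div R.pair.num) = ModelFrobenioid.div R.pair.num)
  (hinvp : ∀ y : T.PiX, y ∈ T.PiYdd →
    pull tf.divisorMonoid ((BiKummerSetting.mkOfConnectedTemperoid X tf hZ hP NH A₀ hA₀ hA₀').galoisSurj R.AN.base
      R.αData.isGalois (ιX y)).hom (ModelFrobenioid.div R.pair.den) = ModelFrobenioid.div R.pair.den)

section AnyVocabulary

variable {Vv : FrobenioidThetaBiKummer.BiKummerVocabStub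
    (ofConnectedTemperoidData h Q odd_l R ιX K' constEmb constEmb_injective hinvc hinvp)}
  (Rm : ConstantMultiple.RootMorphismData
    (ofConnectedTemperoidData h Q odd_l R ιX K' constEmb constEmb_injective hinvc hinvp) Vv)

/-- **`hL` is a THEOREM given `hL'` at the genuine §5 data**: the class of `B_N` is not principal as soon as no positive power of the
class of `B_{N'}` is (`β_{N,N'}` isometry).  [cite: MochizukiEtTh2009, Cor 5.12 proof p.340–341 (PDF pp.114–115)] -/
theorem cls_BN_ne_divB_ofConnectedTemperoidData_of_hL'
    (hL' : ∀ k : ℕ, 0 < k → ∀ u : tf.ratFnFunctor.obj (op Rm.BN'.base),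
      Rm.BN'.cls ^ k ≠ divB tf.divisorMonoid tf.ratFnFunctor tf.divBNatTrans (op Rm.BN'.base) u) :
    ∀ u : tf.ratFnFunctor.obj (op R.BN.base),
      R.BN.cls ≠ divB tf.divisorMonoid tf.ratFnFunctor tf.divBNatTrans (op R.BN.base) u :=
  Rm.cls_BN_ne_divB_of_model rfl hL'

/-- **[EtTh] Cor. 5.12 (i) at the GENUINE §5 data over `B^temp(Π^tp_X)⁰`, modulo ONE clause** (F-0505 instance form): for every
Cor. 5.12 datum `Rm`, «The isomorphism classes of `A_N`, `B_N`, and `B_{N'}` are distinct» ⟸ `hL'` alone («no positive tensor power of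
the line bundle determining `B_{N'}` is trivial», p.341 l.5–6, model form); `A_N` Frobenius-trivial, `B_N` Aut-ample, `B_N^bs` Galois,
`Φ` divisorial and now also the `B_N` line-bundle clause are theorems at this datum.
[cite: MochizukiEtTh2009, Cor 5.12 (i) p.339 (PDF p.113), proof p.340–341 (PDF pp.114–115)] -/
theorem isoClassesDistinct_ofConnectedTemperoidData_of_hL'
    (hL' : ∀ k : ℕ, 0 < k → ∀ u : tf.ratFnFunctor.obj (op Rm.BN'.base),
      Rm.BN'.cls ^ k ≠ divB tf.divisorMonoid tf.ratFnFunctor tf.divBNatTrans (op Rm.BN'.base) u) :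
    ConstantMultiple.IsoClassesDistinct Rm :=
  isoClassesDistinct_ofConnectedTemperoidData h Q odd_l R ιX K' constEmb constEmb_injective hinvc hinvp Rm
    (cls_BN_ne_divB_ofConnectedTemperoidData_of_hL' h Q odd_l R ιX K' constEmb constEmb_injective hinvc hinvp Rm hL') hL'

/-- **[EtTh] Cor. 5.12 (iii) at the GENUINE §5 data, every `ζ : B_{N'} → B_N`, modulo ONE clause** (F-0501 instance form), by
abc-iut-L2-t4's PROVED reduction (iii) ⟸ (i) (Lemma 5.11, p407037).
[cite: MochizukiEtTh2009, Cor 5.12 (iii) p.340 (PDF p.114), proof p.341 (PDF p.115)] -/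
theorem constantMultipleIndeterminacy_ofConnectedTemperoidData_of_hL'
    (hL' : ∀ k : ℕ, 0 < k → ∀ u : tf.ratFnFunctor.obj (op Rm.BN'.base),
      Rm.BN'.cls ^ k ≠ divB tf.divisorMonoid tf.ratFnFunctor tf.divBNatTrans (op Rm.BN'.base) u)
    (ζ : Rm.BN' ⟶ (ofConnectedTemperoidData h Q odd_l R ιX K' constEmb constEmb_injective hinvc hinvp).BN) :
    ConstantMultiple.ConstantMultipleIndeterminacy Rm ζ :=
  ConstantMultiple.constantMultipleIndeterminacy_of Rm
    (isoClassesDistinct_ofConnectedTemperoidData_of_hL' h Q odd_l R ιX K' constEmb constEmb_injective hinvc hinvp Rm hL') ζ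

end AnyVocabulary

section GenuineVocabulary

variable (pf : ∀ {A A' : (BiKummerSetting.mkOfConnectedTemperoid X tf hZ hP NH A₀ hA₀ hA₀').C} (_ : A' ⟶ A),
    (BiKummerSetting.mkOfConnectedTemperoid X tf hZ hP NH A₀ hA₀ hA₀').biratUnits A →
      (BiKummerSetting.mkOfConnectedTemperoid X tf hZ hP NH A₀ hA₀ hA₀').biratUnits A')
  (e : ∀ A : (BiKummerSetting.mkOfConnectedTemperoid X tf hZ hP NH A₀ hA₀ hA₀').C,
    (ofConnectedTemperoidData h Q odd_l R ιX K' constEmb constEmb_injective hinvc hinvp).biratUnits A ≃*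
      (BiKummerSetting.mkOfConnectedTemperoid X tf hZ hP NH A₀ hA₀ hA₀').biratUnits A)
  (Rm : ConstantMultiple.RootMorphismData
    (ofConnectedTemperoidData h Q odd_l R ιX K' constEmb constEmb_injective hinvc hinvp)
    (FrobenioidThetaBiKummer.BiKummerVocabStub.ofBiKummerSetting
      (BiKummerSetting.mkOfConnectedTemperoid X tf hZ hP NH A₀ hA₀ hA₀') pf
      (ofConnectedTemperoidData h Q odd_l R ιX K' constEmb constEmb_injective hinvc hinvp) e))

/-- **[EtTh] Cor. 5.12 — (i), (ii), (iii) — at the GENUINE §5 data with the GENUINE Prop. 5.2 (i) vocabulary, modulo EXACTLY ONE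
displayed clause `hL'`** (F-0502 instance form): abc-iut-f-112's `constantMultipleIndeterminacyOfSystems_ofBiKummerSetting` (p445319; (ii)
unconditional there) with its `hL` binder now a theorem.  The one remaining input is print's §1 sentence for `B_{N'}` (GAP G-f112-1,
halved).  [cite: MochizukiEtTh2009, Cor 5.12 p.339–341 (PDF pp.113–115)] -/
theorem constantMultipleIndeterminacyOfSystems_ofBiKummerSetting_of_hL'
    (hL' : ∀ k : ℕ, 0 < k → ∀ u : tf.ratFnFunctor.obj (op Rm.BN'.base),
      Rm.BN'.cls ^ k ≠ divB tf.divisorMonoid tf.ratFnFunctor tf.divBNatTrans (op Rm.BN'.base) u) :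
    ConstantMultiple.ConstantMultipleIndeterminacyOfSystems Rm :=
  constantMultipleIndeterminacyOfSystems_ofBiKummerSetting h Q odd_l R ιX K' constEmb constEmb_injective hinvc hinvp pf e Rm
    (cls_BN_ne_divB_ofConnectedTemperoidData_of_hL' h Q odd_l R ιX K' constEmb constEmb_injective hinvc hinvp Rm hL') hL'

/-- **[EtTh] Cor. 5.12 in full at the GENUINE §5 data, in print's §1 DEGREE currency** (p.240 (PDF p.14): `Pic(Y_N) ⥲ ℤ^ℤ` by degrees
on the copies of the projective line): (i) ∧ (ii) ∧ (iii)@`β` ∧ (iii)@every linear `ι` hold as soon as SOME monoid homomorphism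
`deg : Φ(B_{N'}^bs)^gp → ℤ` vanishes on the principal divisors `Div_B(B(B_{N'}^bs))` (a log-meromorphic function has a degree-zero
divisor) and is nonzero on `cls(B_{N'})` (the line bundle `L_{N'}` has degree 1 on each copy).  No other input.
[cite: MochizukiEtTh2009, Cor 5.12 p.339–341 (PDF pp.113–115); §1 p.240 (PDF p.14)] -/
theorem constantMultipleIndeterminacyOfSystems_ofBiKummerSetting_of_degree
    (deg : Algebra.GrothendieckGroup (tf.divisorMonoid.obj (op Rm.BN'.base)) →* Multiplicative ℤ)
    (hdegB : ∀ u : tf.ratFnFunctor.obj (op Rm.BN'.base),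
      deg (divB tf.divisorMonoid tf.ratFnFunctor tf.divBNatTrans (op Rm.BN'.base) u) = 1)
    (hdegL : deg Rm.BN'.cls ≠ 1) :
    ConstantMultiple.ConstantMultipleIndeterminacyOfSystems Rm :=
  constantMultipleIndeterminacyOfSystems_ofBiKummerSetting_of_hL' h Q odd_l R ιX K' constEmb constEmb_injective hinvc hinvp pf e Rm
    (ConstantMultiple.Model.pow_cls_ne_divB_of_degree deg hdegB hdegL)

/-- **[EtTh] Cor. 5.12 (i) at the GENUINE §5 data in the degree currency** (F-0505 instance form).
[cite: MochizukiEtTh2009, Cor 5.12 (i) p.339 (PDF p.113); §1 p.240 (PDF p.14)] -/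
theorem isoClassesDistinct_ofBiKummerSetting_of_degree
    (deg : Algebra.GrothendieckGroup (tf.divisorMonoid.obj (op Rm.BN'.base)) →* Multiplicative ℤ)
    (hdegB : ∀ u : tf.ratFnFunctor.obj (op Rm.BN'.base),
      deg (divB tf.divisorMonoid tf.ratFnFunctor tf.divBNatTrans (op Rm.BN'.base) u) = 1)
    (hdegL : deg Rm.BN'.cls ≠ 1) :
    ConstantMultiple.IsoClassesDistinct Rm :=
  (constantMultipleIndeterminacyOfSystems_ofBiKummerSetting_of_degree h Q odd_l R ιX K' constEmb constEmb_injective hinvc hinvp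
    pf e Rm deg hdegB hdegL).1

end GenuineVocabulary

end ThetaFrobenioid

end Literature.AnabelianGeometry.EtaleTheta

end
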